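import Summits.QuantumFields.YangMills.Theorems.BalabanUVNodesN13GaugeFixingAxialLayers

/-!
# Route `CoarseStiffnessTail` — THE FULL COMB-TREE GAUGE: `haar(B)^{|T|−1}·∫F = ∫ F·Π_{tree} 1_B` for a SPANNING tree of Bałaban's torus
# (lead's certificate, seat `ym-line-cst-p1` g15; helper on 25301 `CappedCoarseStiffnessL`, stub S3 = uniform mean action)

THE TREE.  On the torus `T₁^{(j)}` of any `Params` (`n = 2L^{m+K−j}` sites per direction, coordinates in `ZMod n`, root `0`) the COMB
`𝒯 = {⟨x, e_k⟩ : x_i = 0 for i < k, val(x_k) < n − 1}` (`k` ranges over all directions): the path from the root to `y` first walks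
direction `d−1`, then `d−2`, …, then direction `0`; every site but the root is the target of exactly one tree bond, `|𝒯| = |T| − 1`
(`card_combTree`).

THE IDENTITY (`pow_mul_integral_eq_prod_indicator_combTree`, any gauge group with Haar data and measurable multiplication, any
measurable `B ⊆ G`, any gauge-invariant integrable `F`):  `haar(B)^{|𝒯|}·∫ F dU = ∫ F(U)·Π_{b∈𝒯} 1_B(U(b)) dU`.
Proof: gauge the stages `k = d−1, d−2, …, 0` in this order and, inside stage `k`, the layers `val(x_k) = 0, 1, …, n−2` in this order,
each by the tree's sequential Faddeev–Popov step (`N13GaugeFixingSequentialLayer.pow_mul_integral_eq_of_layer`): a layer is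
target-disjoint, no target is a source of the same layer (`val(x_k)` goes from `t` to `t+1`), and its targets — `x_i = 0 (i < k)`,
`val(x_k) = t+1 ≥ 1` — are endpoints of no bond gauged before (those have `x_k = 0` in stages `> k`, `val(x_k) ≤ t` in earlier layers).
The tree's `N13GaugeFixingAxialLayers` is the stage `k = 0` alone (`|T|(1 − 1/n)` bonds, a forest of `n^{d−1}` lines); gauging the
full tree removes the `1/n` boundary term from the Gaussian LOWER bound on `log Z_P` (companion `…LAbelianFlatLowerBound`).

HONEST SCOPE.  Kernel measure theory and torus bookkeeping; nothing of Bałaban's is asserted; the crux 25301, its stubs S1/S2/S3,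
`HistoryTailL` 19936 stay OPEN; `YM3TorusSU2` (R3, RECORD rung, not Clay) is NOT proved; the Yang–Mills mass gap is NOT touched.

References: T. Bałaban, CMP **109** (1987) 249–301 [Balaban1987RG1] ((0.15)–(0.16) pp.254–255, the axial gauge bookkeeping);
I. Montvay, G. Münster, *Quantum Fields on a Lattice* (1994) §3.2.5 [MontvayMunster1994] (maximal trees).
-/

noncomputable section

open MeasureTheory
open scoped BigOperators

namespace Summit.QuantumFields.YangMills.Theorems.CoarseStiffnessTailCombTreeGauge

open Literature.MathematicalPhysics.QuantumFieldTheory.Balaban1983to89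
open Missing
open Summit.QuantumFields.YangMills.BalabanUVNodes.N13GaugeFixingSequentialLayer (pow_mul_integral_eq_of_layer)
open Summit.QuantumFields.YangMills.BalabanUVNodes.N13GaugeFixingAxialLayers (val_shift_dir shift_apply_ne)

variable (P : Params) (j : ℕ)

/-! ## §1 The comb tree, stage by stage and layer by layer -/

section Tree

/-- `val(−1) = n − 1`, so `val c < n − 1 → c ≠ −1`… in the form used: `val c < n − 1 → val c + 1 < n`. [folklore] -/
theorem val_add_one_lt_of_val_lt (c : ZMod (P.sitesPerDir j)) (hc : c.val < P.sitesPerDir j - 1) : c.val + 1 < P.sitesPerDir j := by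
  have := Nat.pos_of_ne_zero (P.sitesPerDir_ne_zero j)
  omega

variable {G : Type*} [GaugeGroup G] [MeasurableSpace G] [HaarData G] [MeasurableMul₂ G]

/-- **THE LAYERED COMB GAUGE (stage `k₀`, height `t`)**: for every `k₀ ≤ d`, every `t + 1 ≤ n`, every measurable `B` and every gauge-invariant
integrable `F`, the Faddeev–Popov identity `haar(B)^{|A|}·∫F = ∫F·Π_A 1_B` holds for the family
`A(k₀, t) = {⟨x, e_k⟩ : x_i = 0 (i < k), [k₀ < k ∧ val(x_k) < n−1] ∨ [k = k₀ ∧ val(x_k) < t]}` (all stages above `k₀` complete, stage `k₀` up to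
height `t`).  Double induction: on `d − k₀`, and inside a stage on `t`. [cite: Balaban1987RG1, (0.15)–(0.16) pp.254–255 (bookkeeping)] -/
theorem pow_mul_integral_eq_prod_indicator_comb {B : Set G} (hB : MeasurableSet B) {F : GaugeField P j G → ℝ}
    (hF : GaugeField.GaugeInvariant F) (hFi : Integrable F (fieldMeasure P j G)) :
    ∀ (m k₀ : ℕ), k₀ + m = P.d → ∀ (t : ℕ), t + 1 ≤ P.sitesPerDir j →
      (HaarData.haar : Measure G).real B ^ (Finset.univ.filter fun b : PBond P j =>
          (∀ i, i < b.dir → b.src i = 0) ∧ ((k₀ < b.dir.val ∧ (b.src b.dir).val < P.sitesPerDir j - 1) ∨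
            (b.dir.val = k₀ ∧ (b.src b.dir).val < t))).card *
        ∫ U, F U ∂(fieldMeasure P j G) =
      ∫ U, F U * ∏ b ∈ (Finset.univ.filter fun b : PBond P j =>
          (∀ i, i < b.dir → b.src i = 0) ∧ ((k₀ < b.dir.val ∧ (b.src b.dir).val < P.sitesPerDir j - 1) ∨
            (b.dir.val = k₀ ∧ (b.src b.dir).val < t))),
        B.indicator (fun _ => (1 : ℝ)) (U b) ∂(fieldMeasure P j G) := by
  classical
  set n : ℕ := P.sitesPerDir j with hn
  have hnpos : 0 < n := Nat.pos_of_ne_zero (P.sitesPerDir_ne_zero j)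
  intro m
  induction m with
  | zero =>
    -- `k₀ = d`: the family is empty whatever `t`
    intro k₀ hk₀ t _
    have h0 : (Finset.univ.filter fun b : PBond P j =>
        (∀ i, i < b.dir → b.src i = 0) ∧ ((k₀ < b.dir.val ∧ (b.src b.dir).val < n - 1) ∨
          (b.dir.val = k₀ ∧ (b.src b.dir).val < t))) = ∅ := by
      refine Finset.filter_eq_empty_iff.2 fun b _ => ?_
      have := b.dir.isLt
      rintro ⟨_, (⟨h1, _⟩ | ⟨h1, _⟩)⟩ <;> omega
    rw [h0]
    simp
  | succ m ih =>
    intro k₀ hk₀ t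
    have hk₀d : k₀ < P.d := by omega
    -- inner induction on the height `t`
    induction t with
    | zero =>
      intro _
      -- `A(k₀, 0) = A(k₀ + 1, n − 1)`
      have heq : (Finset.univ.filter fun b : PBond P j =>
          (∀ i, i < b.dir → b.src i = 0) ∧ ((k₀ < b.dir.val ∧ (b.src b.dir).val < n - 1) ∨
            (b.dir.val = k₀ ∧ (b.src b.dir).val < 0))) =
          Finset.univ.filter fun b : PBond P j =>
          (∀ i, i < b.dir → b.src i = 0) ∧ ((k₀ + 1 < b.dir.val ∧ (b.src b.dir).val < n - 1) ∨
            (b.dir.val = k₀ + 1 ∧ (b.src b.dir).val < n - 1)) := by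
        ext b
        simp only [Finset.mem_filter, Finset.mem_univ, true_and, Nat.not_lt_zero, and_false, or_false]
        constructor
        · rintro ⟨h0, h1, h2⟩
          refine ⟨h0, ?_⟩
          rcases Nat.lt_or_ge (k₀ + 1) b.dir.val with h | h
          · exact Or.inl ⟨h, h2⟩
          · exact Or.inr ⟨by omega, h2⟩
        · rintro ⟨h0, (⟨h1, h2⟩ | ⟨h1, h2⟩)⟩
          · exact ⟨h0, by omega, h2⟩
          · exact ⟨h0, by omega, h2⟩
      rw [heq]
      exact ih (k₀ + 1) (by omega) (n - 1) (by omega)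
    | succ t iht =>
      intro ht
      have hIH := iht (by omega)
      -- the new layer: direction `k₀`, height `t`
      set kf : Fin P.d := ⟨k₀, hk₀d⟩ with hkf
      set S : Finset (PBond P j) := Finset.univ.filter fun b : PBond P j =>
          (∀ i, i < b.dir → b.src i = 0) ∧ ((k₀ < b.dir.val ∧ (b.src b.dir).val < n - 1) ∨
            (b.dir.val = k₀ ∧ (b.src b.dir).val < t)) with hS
      set M : Finset (PBond P j) := Finset.univ.filter fun b : PBond P j =>
          (∀ i, i < b.dir → b.src i = 0) ∧ b.dir = kf ∧ (b.src b.dir).val = t with hM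
      have hmemS : ∀ {b : PBond P j}, b ∈ S ↔ (∀ i, i < b.dir → b.src i = 0) ∧
          ((k₀ < b.dir.val ∧ (b.src b.dir).val < n - 1) ∨ (b.dir.val = k₀ ∧ (b.src b.dir).val < t)) := by
        intro b; simp [hS]
      have hmemM : ∀ {b : PBond P j}, b ∈ M ↔ (∀ i, i < b.dir → b.src i = 0) ∧ b.dir = kf ∧ (b.src b.dir).val = t := by
        intro b; simp [hM]
      have hunion : (Finset.univ.filter fun b : PBond P j =>
          (∀ i, i < b.dir → b.src i = 0) ∧ ((k₀ < b.dir.val ∧ (b.src b.dir).val < n - 1) ∨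
            (b.dir.val = k₀ ∧ (b.src b.dir).val < t + 1))) = S ∪ M := by
        ext b
        simp only [Finset.mem_union, hmemS, hmemM, Finset.mem_filter, Finset.mem_univ, true_and]
        constructor
        · rintro ⟨h0, (⟨h1, h2⟩ | ⟨h1, h2⟩)⟩
          · exact Or.inl ⟨h0, Or.inl ⟨h1, h2⟩⟩
          · rcases Nat.lt_succ_iff_lt_or_eq.1 h2 with h | h
            · exact Or.inl ⟨h0, Or.inr ⟨h1, h⟩⟩
            · exact Or.inr ⟨h0, Fin.ext h1, h⟩
        · rintro (⟨h0, (⟨h1, h2⟩ | ⟨h1, h2⟩)⟩ | ⟨h0, h1, h2⟩)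
          · exact ⟨h0, Or.inl ⟨h1, h2⟩⟩
          · exact ⟨h0, Or.inr ⟨h1, Nat.lt_succ_of_lt h2⟩⟩
          · exact ⟨h0, Or.inr ⟨by rw [h1], by omega⟩⟩
      have hdisj : Disjoint S M := by
        rw [Finset.disjoint_left]
        intro b hbS hbM
        obtain ⟨_, hd, hv⟩ := hmemM.1 hbM
        rcases (hmemS.1 hbS).2 with ⟨h1, _⟩ | ⟨_, h2⟩
        · rw [hd] at h1; simp [hkf] at h1
        · omega
      -- the targets of the layer: `x_i = 0 (i < k₀)`, `val x_{k₀} = t + 1`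
      have htgt_val : ∀ b ∈ M, (b.tgt kf).val = t + 1 := by
        intro b hb
        obtain ⟨_, hd, hv⟩ := hmemM.1 hb
        rw [PBond.tgt, hd]
        rw [hd] at hv
        have := val_shift_dir P j b.src kf (by omega)
        rw [hv] at this
        exact this
      have htgt_lo : ∀ b ∈ M, ∀ i : Fin P.d, i < kf → b.tgt i = 0 := by
        intro b hb i hi
        obtain ⟨h0, hd, _⟩ := hmemM.1 hb
        rw [PBond.tgt, hd, shift_apply_ne P j _ _ _ (Fin.ne_of_lt hi)]
        exact h0 i (hd ▸ hi)
      have hsrc : ∀ b ∈ M, ∀ b' ∈ M, b'.tgt ≠ b.src := by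
        intro b hb b' hb' heq
        have h1 := htgt_val b' hb'
        obtain ⟨_, hd, hv⟩ := hmemM.1 hb
        rw [heq] at h1
        rw [hd] at hv
        omega
      have hinj : Set.InjOn PBond.tgt (M : Set (PBond P j)) := by
        intro b hb b' hb' heq
        have hbd := (hmemM.1 (Finset.mem_coe.1 hb)).2.1
        have hb'd := (hmemM.1 (Finset.mem_coe.1 hb')).2.1
        have hs : b.src = b'.src := by
          funext κ
          have hκ := congrFun heq κ
          simp only [PBond.tgt, hbd, hb'd] at hκ
          by_cases h : κ = kf
          · subst h
            have e1 : (b.src.shift kf) kf = b.src kf + 1 := by simp [Site.shift]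
            have e2 : (b'.src.shift kf) kf = b'.src kf + 1 := by simp [Site.shift]
            rw [e1, e2] at hκ
            exact add_right_cancel hκ
          · rwa [shift_apply_ne P j _ _ _ h, shift_apply_ne P j _ _ _ h] at hκ
        cases b; cases b'
        simp only at hs hbd hb'd
        subst hs; subst hbd; subst hb'd; rfl
      have havoid : ∀ b ∈ M, ∀ b' ∈ S, b.tgt ≠ b'.src ∧ b.tgt ≠ b'.tgt := by
        intro b hb b' hb'
        have h1 := htgt_val b hb
        obtain ⟨h0', hcase⟩ := hmemS.1 hb'
        rcases hcase with ⟨hlt, _⟩ | ⟨hd', hv'⟩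
        · -- `b'` in a higher stage: both endpoints have `x_{k₀} = 0`
          have hk : kf < b'.dir := by
            show kf.val < b'.dir.val; exact hlt
          have hs0 : b'.src kf = 0 := h0' kf hk
          have ht0 : b'.tgt kf = 0 := by
            rw [PBond.tgt, shift_apply_ne P j _ _ _ (Fin.ne_of_lt hk), hs0]
          constructor
          · intro heq; rw [heq, hs0, ZMod.val_zero] at h1; omega
          · intro heq; rw [heq, ht0, ZMod.val_zero] at h1; omega
        · -- `b'` in the same stage, lower layer
          have hd'' : b'.dir = kf := Fin.ext hd'
          have h2 : (b'.tgt kf).val = (b'.src kf).val + 1 := by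
            rw [PBond.tgt, hd'']; exact val_shift_dir P j b'.src kf (by rw [hd''] at hv'; omega)
          rw [hd''] at hv'
          constructor
          · intro heq; rw [heq] at h1; omega
          · intro heq; rw [heq] at h1; omega
      rw [hunion, Finset.card_union_of_disjoint hdisj]
      exact pow_mul_integral_eq_of_layer S M hdisj hsrc hinj havoid hB hF hFi hIH

/-- **★★ THE FULL COMB-TREE GAUGE**: `haar(B)^{|𝒯|}·∫F = ∫F·Π_{b∈𝒯} 1_B(U b)` for the spanning comb
`𝒯 = {⟨x, e_k⟩ : x_i = 0 (i < k), val(x_k) < n − 1}`, every measurable `B`, every gauge-invariant integrable `F`.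
[cite: Balaban1987RG1, (0.15)–(0.16) pp.254–255 (bookkeeping)] -/
theorem pow_mul_integral_eq_prod_indicator_combTree {B : Set G} (hB : MeasurableSet B) {F : GaugeField P j G → ℝ}
    (hF : GaugeField.GaugeInvariant F) (hFi : Integrable F (fieldMeasure P j G)) :
    (HaarData.haar : Measure G).real B ^ (Finset.univ.filter fun b : PBond P j =>
        (∀ i, i < b.dir → b.src i = 0) ∧ (b.src b.dir).val < P.sitesPerDir j - 1).card * ∫ U, F U ∂(fieldMeasure P j G) =
      ∫ U, F U * ∏ b ∈ (Finset.univ.filter fun b : PBond P j =>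
        (∀ i, i < b.dir → b.src i = 0) ∧ (b.src b.dir).val < P.sitesPerDir j - 1),
        B.indicator (fun _ => (1 : ℝ)) (U b) ∂(fieldMeasure P j G) := by
  classical
  have hn : 0 < P.sitesPerDir j := Nat.pos_of_ne_zero (P.sitesPerDir_ne_zero j)
  have h := pow_mul_integral_eq_prod_indicator_comb P j hB hF hFi P.d 0 (by omega) (P.sitesPerDir j - 1) (by omega)
  have heq : (Finset.univ.filter fun b : PBond P j =>
      (∀ i, i < b.dir → b.src i = 0) ∧ ((0 < b.dir.val ∧ (b.src b.dir).val < P.sitesPerDir j - 1) ∨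
        (b.dir.val = 0 ∧ (b.src b.dir).val < P.sitesPerDir j - 1))) =
      Finset.univ.filter fun b : PBond P j => (∀ i, i < b.dir → b.src i = 0) ∧ (b.src b.dir).val < P.sitesPerDir j - 1 := by
    ext b
    simp only [Finset.mem_filter, Finset.mem_univ, true_and]
    constructor
    · rintro ⟨h0, (⟨_, h2⟩ | ⟨_, h2⟩)⟩ <;> exact ⟨h0, h2⟩
    · rintro ⟨h0, h2⟩
      rcases Nat.eq_zero_or_pos b.dir.val with h | h
      · exact ⟨h0, Or.inr ⟨h, h2⟩⟩
      · exact ⟨h0, Or.inl ⟨h, h2⟩⟩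
  rw [heq] at h
  exact h

end Tree

/-! ## §2 The comb tree has `|T| − 1` bonds -/

section Count

/-- If `x_i = 0` for `i < a`, `x_a ≠ 0`, and the same for `b`, then `a = b`. [folklore] -/
theorem leastDir0_unique (x : Site P j) {a b : Fin P.d} (ha : ∀ i, i < a → x i = 0) (ha' : x a ≠ 0)
    (hb : ∀ i, i < b → x i = 0) (hb' : x b ≠ 0) : a = b := by
  rcases lt_trichotomy a b with h | h | h
  · exact absurd (hb a h) ha'
  · exact h
  · exact absurd (ha b h) hb'

/-- For `x ≠ 0` there is a least direction `k` with `x_k ≠ 0`. [folklore] -/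
theorem exists_leastDir0 (x : Site P j) (hx : x ≠ fun _ => 0) :
    ∃ k : Fin P.d, (∀ i, i < k → x i = 0) ∧ x k ≠ 0 := by
  classical
  have hne : (Finset.univ.filter fun i : Fin P.d => x i ≠ 0).Nonempty := by
    by_contra h
    rw [Finset.not_nonempty_iff_eq_empty, Finset.filter_eq_empty_iff] at h
    exact hx (funext fun i => by simpa using h (Finset.mem_univ i))
  obtain ⟨k, hk, hmin⟩ := Finset.exists_min_image _ id hne
  refine ⟨k, fun i hi => ?_, (Finset.mem_filter.1 hk).2⟩
  by_contra hxi
  have := hmin i (Finset.mem_filter.2 ⟨Finset.mem_univ _, hxi⟩)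
  exact absurd hi (not_lt.2 this)

/-- **THE COUNT**: `|𝒯| = |T₁^{(j)}| − 1` — `b ↦ tgt b` maps the comb bijectively onto the non-root sites (the direction of the bond into `y`
is the least `k` with `y_k ≠ 0`). [folklore] -/
theorem card_combTree :
    (Finset.univ.filter fun b : PBond P j =>
        (∀ i, i < b.dir → b.src i = 0) ∧ (b.src b.dir).val < P.sitesPerDir j - 1).card = Fintype.card (Site P j) - 1 := by
  classical
  set n : ℕ := P.sitesPerDir j with hn
  have hnpos : 0 < n := Nat.pos_of_ne_zero (P.sitesPerDir_ne_zero j)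
  have hroot : (Finset.univ.filter fun x : Site P j => x ≠ fun _ => 0).card = Fintype.card (Site P j) - 1 := by
    rw [Finset.filter_ne' Finset.univ, Finset.card_erase_of_mem (Finset.mem_univ _), Finset.card_univ]
  rw [← hroot]
  -- value bookkeeping at the target
  have htv : ∀ b : PBond P j, (b.src b.dir).val < n - 1 → (b.tgt b.dir).val = (b.src b.dir).val + 1 := fun b hb =>
    val_shift_dir P j b.src b.dir (by omega)
  refine Finset.card_bij (fun b _ => b.tgt) ?_ ?_ ?_
  · intro b hb
    obtain ⟨_, h2⟩ := (Finset.mem_filter.1 hb).2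
    refine Finset.mem_filter.2 ⟨Finset.mem_univ _, fun hc => ?_⟩
    have h := htv b h2
    rw [hc, ZMod.val_zero] at h
    omega
  · intro b hb b' hb' h
    obtain ⟨h1, h2⟩ := (Finset.mem_filter.1 hb).2
    obtain ⟨h1', h2'⟩ := (Finset.mem_filter.1 hb').2
    -- the direction is the least non-zero coordinate of the common target
    have hy1 : ∀ i, i < b.dir → b.tgt i = 0 := fun i hi => by
      rw [PBond.tgt, shift_apply_ne P j _ _ _ (Fin.ne_of_lt hi)]; exact h1 i hi
    have hy2 : b.tgt b.dir ≠ 0 := fun hc => by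
      have := htv b h2; rw [hc, ZMod.val_zero] at this; omega
    have hy1' : ∀ i, i < b'.dir → b'.tgt i = 0 := fun i hi => by
      rw [PBond.tgt, shift_apply_ne P j _ _ _ (Fin.ne_of_lt hi)]; exact h1' i hi
    have hy2' : b'.tgt b'.dir ≠ 0 := fun hc => by
      have := htv b' h2'; rw [hc, ZMod.val_zero] at this; omega
    have htt : b.tgt = b'.tgt := h
    rw [htt] at hy1 hy2
    have hdir : b.dir = b'.dir := leastDir0_unique P j b'.tgt hy1 hy2 hy1' hy2'
    have hs : b.src = b'.src := by
      funext κ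
      have hκ := congrFun htt κ
      simp only [PBond.tgt, hdir] at hκ
      by_cases hk : κ = b'.dir
      · subst hk
        have e1 : (b.src.shift b'.dir) b'.dir = b.src b'.dir + 1 := by simp [Site.shift]
        have e2 : (b'.src.shift b'.dir) b'.dir = b'.src b'.dir + 1 := by simp [Site.shift]
        rw [e1, e2] at hκ
        exact add_right_cancel hκ
      · rwa [shift_apply_ne P j _ _ _ hk, shift_apply_ne P j _ _ _ hk] at hκ
    cases b; cases b'
    simp only at hs hdir
    subst hs; subst hdir; rfl
  · intro y hy
    obtain ⟨k, hk1, hk2⟩ := exists_leastDir0 P j y (Finset.mem_filter.1 hy).2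
    refine ⟨⟨y.unshift k, k⟩, Finset.mem_filter.2 ⟨Finset.mem_univ _, ?_, ?_⟩, ?_⟩
    · intro i hi
      show (Function.update y k (y k - 1)) i = 0
      rw [Function.update_of_ne (Fin.ne_of_lt hi)]; exact hk1 i hi
    · show ((Function.update y k (y k - 1)) k).val < n - 1
      rw [Function.update_self]
      have hyk : (y k).val ≠ 0 := fun h => hk2 ((ZMod.val_eq_zero _).1 h)
      have hlt : (y k).val < n := ZMod.val_lt _
      have h1n : 1 < n := by
        rw [hn]; unfold Params.sitesPerDir
        have := Nat.one_le_pow (P.m + P.K - j) P.L P.L_pos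
        omega
      haveI : Fact (1 < n) := ⟨h1n⟩
      have hsub : (y k - 1).val = (y k).val - 1 := by
        rw [ZMod.val_sub (by rw [ZMod.val_one]; omega), ZMod.val_one]
      rw [hsub]; omega
    · show (y.unshift k).shift k = y
      funext κ
      by_cases hk : κ = k
      · subst hk; simp [Site.shift, Site.unshift]
      · simp [Site.shift, Site.unshift, hk]

end Count

end Summit.QuantumFields.YangMills.Theorems.CoarseStiffnessTailCombTreeGauge

end
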